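import Summits.HodgeConjecture.HodgeConjecture.Theorems.CyclicUnitaryPowersFermatAffineEigenfunctionsDescent

/-!
# Programme PG-FERMAT, brick F3 (part 3/3): holomorphic torus-eigenfunctions of polynomial growth `m` with exponent sum `> m` on the affine
# Fermat surface vanish

Prover seat `hodge-nonav-prover-Bx` (g10), cell `hodge-nonav`, programme PG-FERMAT (memo `PROGRAMME-PG-FERMAT-Bx-g10.md`, evidence #48 on
stmt-HodgeConjecture-19544): after `CyclicUnitaryPowersK1OfFermatGenusLe` the binder PG of crux K1-A `VeryGeneralDeckCommutatorsInHg` (route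
`HodgeConjecture/CyclicUnitaryPowers`) is reduced to `h^{2,0}(X²_p) ≤ C(p−1,3)` for the Fermat surface of prime degree `p ≥ 5`, i.e. to the vanishing
of the holomorphic `2`-forms in the `μ_p⁴`-eigenlines with `|α| = 2`; on the affine piece these are `g · Res(x₃^{p−4}Ω/F)` with `g` a holomorphic
`μ_p³`-eigenfunction of polynomial growth on the affine Fermat surface `U = {y ∈ ℂ³ : y₀^p + y₁^p + y₂^p = −1}`. The three files
`CyclicUnitaryPowersFermatAffineEigenfunctions{Roots,Descent,}` prove the purely ANALYTIC statement (no Hodge theory, no schemes; Mathlib + the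
tree's several-complex-variables library `Literature/Analysis/Complex/{RiemannExtension, PolynomialGrowthLiouvilleSCV, BranchedCoveringCharPolySCV}`).
Sources of the method: J.-P. Serre, GAGA (1956) n° 19–20; L. Hörmander (1973) Thm. 2.2.7; T. Shioda, Math. Ann. 245 (1979) §1.
Sorry-free; no definition, no named fact; helper (`--supports … --as helper`); nothing here says HC ∕ HC_AV is proved.

* `eq_zero_of_eqOn_zero_off_axes` — the points of `U` with all coordinates non-zero approximate every point of `U` (explicit curve through a
  local root), so a locally-holomorphic `g` vanishing there vanishes on `U`.
* **`eqOn_zero_of_eigenfunction_of_growth`** (THE BRICK) — `g` locally holomorphic on `U`, `g(ζ • y) = (∏ ζᵢ^{cᵢ}) g(y)` (`ζᵢ^p = 1`, `cᵢ < p`),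
  `|g(y)| ≤ C(1+|y|)^m`, `m < Σ cᵢ` ⟹ `g = 0` on `U`: the invariant `H = g ∏ yᵢ^{eᵢ}` (`eᵢ = p − cᵢ` for `cᵢ ≥ 1`) is a polynomial `P(y₀,y₁)`
  of degree `≤ m + Σ eᵢ < p · #{i : cᵢ ≥ 1}` (part 2) with exponents divisible by `p`, divisible by `X₀`/`X₁` when `c₀`/`c₁ ≥ 1` and vanishing
  on the branch curve when `c₂ ≥ 1` (part 1) — no monomial survives the count. With `m = p − 4` and `Σ cᵢ ≥ p − 2` this is the vanishing
  of the `|α| = 2` eigen-`2`-forms of the Fermat surface (bricks F1/F2/F4 of the programme supply the translation).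
-/

noncomputable section

set_option linter.dupNamespace false

open Complex Set Filter Metric Function
open scoped Topology

namespace Summit.HodgeConjecture.HodgeConjecture.Theorems.CyclicUnitaryPowersFermatAffineEigenfunctions

open Literature.Analysis.Complex

/-! ### §3 The brick: eigenfunctions with `Σ cᵢ > m` vanish -/

section Brick

variable {p : ℕ}

/-- Points of the affine Fermat surface with all coordinates non-zero approximate every point: if `g` agrees near `z ∈ U` with a holomorphic
(hence continuous) `G` on `U` and vanishes at the points of `U` with all coordinates non-zero, then `g z = 0`. -/
theorem eq_zero_of_eqOn_zero_off_axes (hp : 1 ≤ p) {g : (Fin 3 → ℂ) → ℂ} {z : Fin 3 → ℂ} (hz : ∑ i, z i ^ p = -1)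
    {W : Set (Fin 3 → ℂ)} (hWo : IsOpen W) (hzW : z ∈ W) {G : (Fin 3 → ℂ) → ℂ} (hG : DifferentiableOn ℂ G W)
    (hGg : ∀ y ∈ W, ∑ i, y i ^ p = -1 → G y = g y)
    (h0 : ∀ y : Fin 3 → ℂ, ∑ i, y i ^ p = -1 → (∀ i, y i ≠ 0) → g y = 0) : g z = 0 := by
  classical
  have hp0 : p ≠ 0 := by omega
  -- a non-zero coordinate `j`
  obtain ⟨j, hj⟩ : ∃ j, z j ≠ 0 := by
    by_contra hcon
    push Not at hcon
    have : ∑ i, z i ^ p = 0 := Finset.sum_eq_zero fun i _ ↦ by rw [hcon i, zero_pow hp0]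
    rw [this] at hz; norm_num at hz
  -- the other coordinates moved by `t`, the `j`-th recomputed through a local root
  set q : ℂ → ℂ := fun t ↦ -1 - ∑ i ∈ Finset.univ.erase j, (z i + t) ^ p with hq
  have hq0 : q 0 = z j ^ p := by
    simp only [hq, add_zero]
    rw [← hz, ← Finset.add_sum_erase _ _ (Finset.mem_univ j)]; ring
  have hzj : z j ^ p ≠ 0 := pow_ne_zero _ hj
  obtain ⟨V, hVo, hV0, ρ, hρ, hρ0, hρp⟩ := exists_local_root hp hzj rfl
  rw [← hq0] at hV0 hρ0
  have hqcont : Continuous q := by simp only [hq]; fun_prop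
  have hρcont : ContinuousAt ρ (q 0) := (hρ.differentiableAt (hVo.mem_nhds hV0)).continuousAt
  set y : ℂ → (Fin 3 → ℂ) := fun t ↦ Function.update (fun i ↦ z i + t) j (ρ (q t)) with hy
  -- `y t → z`
  have hy_tend : Tendsto y (𝓝 0) (𝓝 z) := by
    rw [tendsto_pi_nhds]
    intro i
    by_cases hij : i = j
    · subst hij
      have e1 : (fun t ↦ y t i) = fun t ↦ ρ (q t) := by funext t; simp [hy]
      rw [e1, show z i = ρ (q 0) from hρ0.symm]
      exact hρcont.tendsto.comp hqcont.continuousAt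
    · have e1 : (fun t ↦ y t i) = fun t ↦ z i + t := by funext t; simp [hy, Function.update_of_ne hij]
      rw [e1]
      have : Tendsto (fun t : ℂ ↦ z i + t) (𝓝 0) (𝓝 (z i + 0)) := tendsto_const_nhds.add tendsto_id
      rwa [add_zero] at this
  -- eventually (for `t ≠ 0` small) `y t ∈ U`, all coordinates non-zero, and `y t ∈ W`
  have hyU : ∀ᶠ t in 𝓝 0, ∑ i, y t i ^ p = -1 := by
    filter_upwards [hqcont.continuousAt.preimage_mem_nhds (hVo.mem_nhds hV0)] with t ht
    rw [← Finset.add_sum_erase _ _ (Finset.mem_univ j)]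
    simp only [hy, Function.update_self]
    rw [hρp _ ht, Finset.sum_congr rfl fun i hi ↦ by rw [Function.update_of_ne (Finset.ne_of_mem_erase hi)]]
    simp only [hq]; ring
  have hyne : ∀ᶠ t in 𝓝[≠] 0, ∀ i, y t i ≠ 0 := by
    -- the `j`-th coordinate tends to `z j ≠ 0`; the others are `z i + t`
    have hj' : ∀ᶠ t in 𝓝 0, y t j ≠ 0 := (tendsto_pi_nhds.mp hy_tend j).eventually_ne hj
    have hother : ∀ i, i ≠ j → ∀ᶠ t in 𝓝[≠] (0 : ℂ), z i + t ≠ 0 := by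
      intro i hij
      by_cases hzi : z i = 0
      · filter_upwards [self_mem_nhdsWithin] with t ht
        rw [hzi, zero_add]; exact ht
      · have : ∀ᶠ t in 𝓝 (0 : ℂ), z i + t ≠ 0 := by
          have hc : Tendsto (fun t : ℂ ↦ z i + t) (𝓝 0) (𝓝 (z i + 0)) := tendsto_const_nhds.add tendsto_id
          rw [add_zero] at hc
          exact hc.eventually_ne hzi
        exact mem_nhdsWithin_of_mem_nhds this
    have hall : ∀ᶠ t in 𝓝[≠] (0 : ℂ), ∀ i ∈ Finset.univ.erase j, z i + t ≠ 0 :=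
      (Finset.eventually_all _).mpr fun i hi ↦ hother i (Finset.ne_of_mem_erase hi)
    filter_upwards [mem_nhdsWithin_of_mem_nhds hj', hall] with t ht1 ht2 i
    by_cases hij : i = j
    · subst hij; exact ht1
    · simp only [hy, Function.update_of_ne hij]
      exact ht2 i (Finset.mem_erase.mpr ⟨hij, Finset.mem_univ i⟩)
  have hyW : ∀ᶠ t in 𝓝 0, y t ∈ W := hy_tend (hWo.mem_nhds hzW)
  -- `G (y t) = 0` eventually along `𝓝[≠] 0`, and `G (y t) → G z`
  have hGz : Tendsto (fun t ↦ G (y t)) (𝓝[≠] 0) (𝓝 (G z)) :=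
    ((hG.differentiableAt (hWo.mem_nhds hzW)).continuousAt.tendsto.comp hy_tend).mono_left nhdsWithin_le_nhds
  have hG0 : ∀ᶠ t in 𝓝[≠] 0, G (y t) = 0 := by
    filter_upwards [mem_nhdsWithin_of_mem_nhds hyU, hyne, mem_nhdsWithin_of_mem_nhds hyW] with t h1 h2 h3
    rw [hGg _ h3 h1, h0 _ h1 h2]
  have : G z = 0 := by
    have h := hGz.congr' hG0
    exact tendsto_nhds_unique (tendsto_const_nhds) h |>.symm
  rw [← hGg z hzW hz, this]

/-- **THE BRICK.** On the affine Fermat surface `U = {y ∈ ℂ³ : y₀^p + y₁^p + y₂^p = −1}` (`p ≥ 1`), let `g` be locally (near each point of `U`)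
the restriction of a holomorphic function, a `μ_p³`-EIGENFUNCTION `g(ζ • y) = (∏ ζᵢ^{cᵢ}) g(y)` (`ζᵢ^p = 1`) with exponents `cᵢ < p`, of
polynomial growth `|g(y)| ≤ C (1 + |y|)^m` on `U`. If `m < c₀ + c₁ + c₂` then `g = 0` on `U`. (With `m = p − 4` this kills the holomorphic
`2`-forms of the Fermat surface in the eigenlines `|α| = 2`, where `Σ cᵢ ≥ p − 2`.) Proof: `H = g · ∏ yᵢ^{eᵢ}` (`eᵢ = p − cᵢ` for `cᵢ ≥ 1`,
else `0`) is invariant and of growth `m + Σ eᵢ < p · #{i : cᵢ ≥ 1}`, so it is a polynomial `P(y₀, y₁)` of that total degree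
(`exists_mvPolynomial_of_invariant_of_growth`) whose exponents are divisible by `p` (`dvd_of_coeff_ne_zero_of_invariant`), divisible by
`X₀`/`X₁` when `c₀`/`c₁ ≥ 1` (`coeff_eq_zero_of_eval_zero`: `H = 0` where `y₀ = 0`/`y₁ = 0`) and vanishing on the branch curve when `c₂ ≥ 1`
(`y₂ = 0` there); the degree count leaves no monomial. Hence `H = 0`, `g = 0` off the axes, and everywhere (`eq_zero_of_eqOn_zero_off_axes`). -/
theorem eqOn_zero_of_eigenfunction_of_growth (hp : 1 ≤ p) {g : (Fin 3 → ℂ) → ℂ}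
    (hhol : ∀ z : Fin 3 → ℂ, ∑ i, z i ^ p = -1 → ∃ W : Set (Fin 3 → ℂ), IsOpen W ∧ z ∈ W ∧
      ∃ G : (Fin 3 → ℂ) → ℂ, DifferentiableOn ℂ G W ∧ ∀ y ∈ W, ∑ i, y i ^ p = -1 → G y = g y)
    (c : Fin 3 → ℕ) (hc : ∀ i, c i < p)
    (heig : ∀ z : Fin 3 → ℂ, ∑ i, z i ^ p = -1 → ∀ ζ : Fin 3 → ℂ, (∀ i, ζ i ^ p = 1) →
      g (fun i ↦ ζ i * z i) = (∏ i, ζ i ^ c i) * g z)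
    {C : ℝ} {m : ℕ} (hgr : ∀ z : Fin 3 → ℂ, ∑ i, z i ^ p = -1 → ‖g z‖ ≤ C * (1 + ‖z‖) ^ m)
    (hm : m < ∑ i, c i) :
    ∀ z : Fin 3 → ℂ, ∑ i, z i ^ p = -1 → g z = 0 := by
  classical
  have hp0 : p ≠ 0 := by omega
  -- the compensating exponents and the invariant function `H`
  set e : Fin 3 → ℕ := fun i ↦ if c i = 0 then 0 else p - c i with he
  have hce : ∀ i, ∀ ζ : ℂ, ζ ^ p = 1 → ζ ^ c i * ζ ^ e i = 1 := by
    intro i ζ hζ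
    by_cases hci : c i = 0
    · simp [he, hci]
    · rw [← pow_add]
      simp only [he, hci, if_false]
      rw [show c i + (p - c i) = p by have := hc i; omega, hζ]
  set H : (Fin 3 → ℂ) → ℂ := fun z ↦ g z * ∏ i, z i ^ e i with hH
  -- (i) `H` is locally a restriction of holomorphic functions
  have hHhol : ∀ z : Fin 3 → ℂ, ∑ i, z i ^ p = -1 → ∃ W : Set (Fin 3 → ℂ), IsOpen W ∧ z ∈ W ∧
      ∃ G : (Fin 3 → ℂ) → ℂ, DifferentiableOn ℂ G W ∧ ∀ y ∈ W, ∑ i, y i ^ p = -1 → G y = H y := by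
    intro z hz
    obtain ⟨W, hWo, hzW, G, hG, hGg⟩ := hhol z hz
    refine ⟨W, hWo, hzW, fun y ↦ G y * ∏ i, y i ^ e i, hG.mul ?_, fun y hy hyU ↦ by simp only [hH, hGg y hy hyU]⟩
    exact (Differentiable.differentiableOn (by fun_prop))
  -- full `μ_p³`-invariance of `H`
  have hHinv : ∀ z : Fin 3 → ℂ, ∑ i, z i ^ p = -1 → ∀ ζ : Fin 3 → ℂ, (∀ i, ζ i ^ p = 1) →
      H (fun i ↦ ζ i * z i) = H z := by
    intro z hz ζ hζ
    simp only [hH]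
    rw [heig z hz ζ hζ]
    have : (∏ i, (ζ i * z i) ^ e i) = (∏ i, ζ i ^ e i) * ∏ i, z i ^ e i := by
      rw [← Finset.prod_mul_distrib]
      exact Finset.prod_congr rfl fun i _ ↦ mul_pow _ _ _
    rw [this]
    have h1 : (∏ i, ζ i ^ c i) * ∏ i, ζ i ^ e i = 1 := by
      rw [← Finset.prod_mul_distrib]
      exact Finset.prod_eq_one fun i _ ↦ hce i (ζ i) (hζ i)
    calc (∏ i, ζ i ^ c i) * g z * ((∏ i, ζ i ^ e i) * ∏ i, z i ^ e i)
        = ((∏ i, ζ i ^ c i) * ∏ i, ζ i ^ e i) * (g z * ∏ i, z i ^ e i) := by ring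
      _ = g z * ∏ i, z i ^ e i := by rw [h1, one_mul]
  -- (ii) invariance in the last coordinate
  have hHinv2 : ∀ z : Fin 3 → ℂ, ∑ i, z i ^ p = -1 → ∀ ζ : ℂ, ζ ^ p = 1 →
      H (Function.update z (Fin.last 2) (ζ * z (Fin.last 2))) = H z := by
    intro z hz ζ hζ
    have : Function.update z (Fin.last 2) (ζ * z (Fin.last 2)) =
        fun i ↦ Function.update (fun _ ↦ (1 : ℂ)) (Fin.last 2) ζ i * z i := by
      funext i
      by_cases hi : i = Fin.last 2
      · subst hi; simp
      · rw [Function.update_of_ne hi, Function.update_of_ne hi, one_mul]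
    rw [this]
    exact hHinv z hz _ fun i ↦ by
      by_cases hi : i = Fin.last 2
      · subst hi; simpa using hζ
      · rw [Function.update_of_ne hi, one_pow]
  -- (iii) growth of `H`
  have hHgr : ∀ z : Fin 3 → ℂ, ∑ i, z i ^ p = -1 → ‖H z‖ ≤ max C 0 * (1 + ‖z‖) ^ (m + ∑ i, e i) := by
    intro z hz
    have h1 : ‖∏ i, z i ^ e i‖ ≤ (1 + ‖z‖) ^ ∑ i, e i := by
      rw [norm_prod, ← Finset.prod_pow_eq_pow_sum]
      refine Finset.prod_le_prod (fun i _ ↦ norm_nonneg _) fun i _ ↦ ?_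
      rw [norm_pow]
      exact pow_le_pow_left₀ (norm_nonneg _) ((norm_le_pi_norm z i).trans (by linarith [norm_nonneg z])) _
    calc ‖H z‖ = ‖g z‖ * ‖∏ i, z i ^ e i‖ := norm_mul _ _
      _ ≤ max C 0 * (1 + ‖z‖) ^ m * (1 + ‖z‖) ^ ∑ i, e i := by
          refine mul_le_mul ((hgr z hz).trans ?_) h1 (norm_nonneg _) (by positivity)
          exact mul_le_mul_of_nonneg_right (le_max_left _ _) (by positivity)
      _ = max C 0 * (1 + ‖z‖) ^ (m + ∑ i, e i) := by rw [pow_add]; ring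
  -- the polynomial
  obtain ⟨P, hPdeg, hPH⟩ := exists_mvPolynomial_of_invariant_of_growth hp hHhol hHinv2 hHgr
  -- base points and their fibres
  have hfib : ∀ a : Fin 2 → ℂ, ∃ w : ℂ, w ^ p = -1 - ∑ j, a j ^ p := fun a ↦ IsAlgClosed.exists_pow_nat_eq _ (by omega)
  have hlift : ∀ (a : Fin 2 → ℂ) (w : ℂ), w ^ p = -1 - ∑ j, a j ^ p →
      ∑ i, (Fin.snoc a w : Fin 3 → ℂ) i ^ p = -1 ∧ MvPolynomial.eval a P = H (Fin.snoc a w) := by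
    intro a w hw
    have hU : ∑ i, (Fin.snoc a w : Fin 3 → ℂ) i ^ p = -1 := by rw [sum_pow_snoc, hw]; ring
    refine ⟨hU, ?_⟩
    rw [← hPH _ hU]
    have : (fun j ↦ (Fin.snoc a w : Fin 3 → ℂ) (Fin.castSucc j)) = a :=
      funext fun j ↦ Fin.snoc_castSucc (α := fun _ ↦ ℂ) (p := a) (x := w) j
    rw [this]
  -- (a) exponents divisible by `p`
  set ζ₀ : ℂ := Complex.exp (2 * Real.pi * Complex.I / p) with hζ₀
  have hζ₀ : IsPrimitiveRoot ζ₀ p := Complex.isPrimitiveRoot_exp p hp0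
  have hζ₀p : ζ₀ ^ p = 1 := hζ₀.pow_eq_one
  have hdvd : ∀ (k : Fin 2) (d : Fin 2 →₀ ℕ), MvPolynomial.coeff d P ≠ 0 → p ∣ d k := by
    intro k d hd
    refine dvd_of_coeff_ne_zero_of_invariant hζ₀ k P (fun a ↦ ?_) hd
    obtain ⟨w, hw⟩ := hfib a
    have hw' : w ^ p = -1 - ∑ j, Function.update a k (ζ₀ * a k) j ^ p := by
      rw [hw]; congr 1
      refine Finset.sum_congr rfl fun j _ ↦ ?_
      by_cases hjk : j = k
      · subst hjk; rw [Function.update_self, mul_pow, hζ₀p, one_mul]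
      · rw [Function.update_of_ne hjk]
    rw [(hlift a w hw).2, (hlift _ w hw').2]
    -- the two lifts differ by the symmetry `ζ = update 1 k ζ₀` (on the first two coordinates)
    have : (Fin.snoc (Function.update a k (ζ₀ * a k)) w : Fin 3 → ℂ) =
        fun i ↦ Function.update (fun _ ↦ (1 : ℂ)) (Fin.castSucc k) ζ₀ i * (Fin.snoc a w : Fin 3 → ℂ) i := by
      funext i
      refine Fin.lastCases ?_ (fun j ↦ ?_) i
      · rw [Fin.snoc_last, Fin.snoc_last, Function.update_of_ne (Fin.castSucc_lt_last k).ne', one_mul]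
      · rw [Fin.snoc_castSucc, Fin.snoc_castSucc]
        by_cases hjk : j = k
        · subst hjk; simp
        · rw [Function.update_of_ne hjk, Function.update_of_ne (fun h ↦ hjk (Fin.castSucc_injective _ h)), one_mul]
    rw [this]
    exact hHinv _ (hlift a w hw).1 _ fun i ↦ by
      by_cases hi : i = Fin.castSucc k
      · subst hi; simpa using hζ₀p
      · simp [Function.update_of_ne hi]
  -- (b) `H = 0` where a coordinate with `cᵢ ≥ 1` vanishes
  have hH0 : ∀ z : Fin 3 → ℂ, ∀ i, c i ≠ 0 → z i = 0 → H z = 0 := by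
    intro z i hci hzi
    simp only [hH]
    have : z i ^ e i = 0 := by
      rw [hzi, zero_pow]
      simp only [he, hci, if_false]
      have := hc i; omega
    rw [Finset.prod_eq_zero (Finset.mem_univ i) this, mul_zero]
  have hcoeff0 : ∀ (k : Fin 2), c (Fin.castSucc k) ≠ 0 → ∀ d : Fin 2 →₀ ℕ, d k = 0 → MvPolynomial.coeff d P = 0 := by
    intro k hck d hdk
    refine coeff_eq_zero_of_eval_zero k P (fun a hak ↦ ?_) hdk
    obtain ⟨w, hw⟩ := hfib a
    rw [(hlift a w hw).2]
    exact hH0 _ (Fin.castSucc k) hck (by rw [Fin.snoc_castSucc]; exact hak)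
  -- (c) `P` vanishes on the branch curve when `c₂ ≥ 1`
  have hbranch : c (Fin.last 2) ≠ 0 → ∀ a : Fin 2 → ℂ, ∑ j, a j ^ p = -1 → MvPolynomial.eval a P = 0 := by
    intro hc2 a ha
    have hw : (0 : ℂ) ^ p = -1 - ∑ j, a j ^ p := by rw [ha, zero_pow hp0]; ring
    rw [(hlift a 0 hw).2]
    exact hH0 _ (Fin.last 2) hc2 (by rw [Fin.snoc_last])
  -- (d) the degree count: `P = 0`
  have hsum_e : m + ∑ i, e i < ∑ i, (c i + e i) := by
    rw [Finset.sum_add_distrib]; omega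
  have hce' : ∀ i, c i + e i = p * (if c i = 0 then 0 else 1) := by
    intro i
    by_cases hci : c i = 0
    · simp [he, hci]
    · simp only [he, hci, if_false, mul_one]; have := hc i; omega
  have hsum3 : ∑ i, (c i + e i) = (c 0 + e 0) + (c 1 + e 1) + (c (Fin.last 2) + e (Fin.last 2)) := by
    rw [Fin.sum_univ_three]; rfl
  -- every monomial `X₀^{d 0} X₁^{d 1}` in the support: `d k = p kₖ` with the constraints below
  have hkey : ∀ d ∈ P.support, ∃ k0 k1 : ℕ, d 0 = p * k0 ∧ d 1 = p * k1 ∧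
      (if c 0 = 0 then 0 else 1) ≤ k0 ∧ (if c 1 = 0 then 0 else 1) ≤ k1 ∧
      k0 + k1 < (if c 0 = 0 then 0 else 1) + (if c 1 = 0 then 0 else 1) + (if c (Fin.last 2) = 0 then 0 else 1) := by
    intro d hd
    have hd' : MvPolynomial.coeff d P ≠ 0 := MvPolynomial.mem_support_iff.mp hd
    obtain ⟨k0, hk0⟩ := hdvd 0 d hd'
    obtain ⟨k1, hk1⟩ := hdvd 1 d hd'
    have hdeg : d 0 + d 1 ≤ m + ∑ i, e i := by
      have h := MvPolynomial.le_totalDegree hd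
      rw [Finsupp.sum_fintype _ _ (fun _ ↦ rfl), Fin.sum_univ_two] at h
      exact h.trans hPdeg
    refine ⟨k0, k1, hk0, hk1, ?_, ?_, ?_⟩
    · split_ifs with hc0
      · exact Nat.zero_le _
      · have h1 : d 0 ≠ 0 := fun h ↦ hd' (hcoeff0 0 hc0 d h)
        rw [hk0] at h1
        exact Nat.one_le_iff_ne_zero.mpr fun hk ↦ h1 (by rw [hk, mul_zero])
    · split_ifs with hc1
      · exact Nat.zero_le _
      · have h1 : d 1 ≠ 0 := fun h ↦ hd' (hcoeff0 1 hc1 d h)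
        rw [hk1] at h1
        exact Nat.one_le_iff_ne_zero.mpr fun hk ↦ h1 (by rw [hk, mul_zero])
    · have hlt : p * (k0 + k1) <
          p * ((if c 0 = 0 then 0 else 1) + (if c 1 = 0 then 0 else 1) + (if c (Fin.last 2) = 0 then 0 else 1)) := by
        have h := hsum_e
        rw [hsum3, hce' 0, hce' 1, hce' (Fin.last 2)] at h
        calc p * (k0 + k1) = d 0 + d 1 := by rw [hk0, hk1, mul_add]
          _ ≤ m + ∑ i, e i := hdeg
          _ < _ := h
          _ = _ := by ring
      exact Nat.lt_of_mul_lt_mul_left hlt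
  have hP0 : P = 0 := by
    by_cases hc2 : c (Fin.last 2) = 0
    · -- no room for any monomial
      refine MvPolynomial.ext _ _ fun d ↦ ?_
      rw [MvPolynomial.coeff_zero]
      by_contra hd
      obtain ⟨k0, k1, -, -, h0, h1, hlt⟩ := hkey d (MvPolynomial.mem_support_iff.mpr hd)
      simp only [hc2] at hlt
      split_ifs at h0 h1 hlt <;> omega
    · -- exactly one candidate exponent `d₀`, killed on the branch curve
      set d₀ : Fin 2 →₀ ℕ := Finsupp.equivFunOnFinite.symm
        ![p * (if c 0 = 0 then 0 else 1), p * (if c 1 = 0 then 0 else 1)] with hd₀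
      have hd₀0 : d₀ 0 = p * (if c 0 = 0 then 0 else 1) := by
        simp only [hd₀, Finsupp.coe_equivFunOnFinite_symm, Matrix.cons_val_zero]
      have hd₀1 : d₀ 1 = p * (if c 1 = 0 then 0 else 1) := by
        simp only [hd₀, Finsupp.coe_equivFunOnFinite_symm, Matrix.cons_val_one, Matrix.cons_val_zero]
      have hsub : ∀ d ∈ P.support, d = d₀ := by
        intro d hd
        obtain ⟨k0, k1, hk0, hk1, h0, h1, hlt⟩ := hkey d hd
        simp only [hc2, if_false] at hlt
        have hk0' : k0 = (if c 0 = 0 then 0 else 1) := by split_ifs at h0 h1 hlt ⊢ <;> omega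
        have hk1' : k1 = (if c 1 = 0 then 0 else 1) := by split_ifs at h0 h1 hlt ⊢ <;> omega
        ext k
        fin_cases k
        · show d 0 = d₀ 0
          rw [hd₀0, hk0, hk0']
        · show d 1 = d₀ 1
          rw [hd₀1, hk1, hk1']
      have hPmono : P = MvPolynomial.monomial d₀ (MvPolynomial.coeff d₀ P) := by
        refine MvPolynomial.ext _ _ fun d ↦ ?_
        rw [MvPolynomial.coeff_monomial]
        split_ifs with h
        · rw [h]
        · exact MvPolynomial.notMem_support_iff.mp fun hd ↦ h (hsub d hd).symm
      -- evaluate at `a* = (1, b)` with `b^p = -2` on the branch curve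
      obtain ⟨b, hb⟩ : ∃ b : ℂ, b ^ p = -2 := IsAlgClosed.exists_pow_nat_eq _ (by omega)
      have hb0 : b ≠ 0 := by rintro rfl; rw [zero_pow hp0] at hb; norm_num at hb
      set a : Fin 2 → ℂ := ![1, b] with ha
      have haB : ∑ j, a j ^ p = -1 := by
        simp only [ha, Fin.sum_univ_two, Matrix.cons_val_zero, Matrix.cons_val_one, one_pow, hb]
        norm_num
      have hev := hbranch hc2 a haB
      rw [hPmono, MvPolynomial.eval_monomial, Finsupp.prod_fintype _ _ (fun _ ↦ pow_zero _)] at hev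
      have hne : (∏ i, a i ^ d₀ i) ≠ 0 := Finset.prod_ne_zero_iff.mpr fun i _ ↦ pow_ne_zero _ (by
        fin_cases i
        · simp [ha]
        · simpa [ha] using hb0)
      have hcoeff : MvPolynomial.coeff d₀ P = 0 := (mul_eq_zero.mp hev).resolve_right hne
      rw [hPmono, hcoeff, map_zero]
  -- (e) `H = 0` on `U`, so `g = 0` off the axes; (f) everywhere
  have hHz : ∀ z : Fin 3 → ℂ, ∑ i, z i ^ p = -1 → H z = 0 := by
    intro z hz
    rw [← hPH z hz, hP0, map_zero]
  have hgoff : ∀ y : Fin 3 → ℂ, ∑ i, y i ^ p = -1 → (∀ i, y i ≠ 0) → g y = 0 := by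
    intro y hy hne
    have h := hHz y hy
    simp only [hH] at h
    exact (mul_eq_zero.mp h).resolve_right (Finset.prod_ne_zero_iff.mpr fun i _ ↦ pow_ne_zero _ (hne i))
  intro z hz
  obtain ⟨W, hWo, hzW, G, hG, hGg⟩ := hhol z hz
  exact eq_zero_of_eqOn_zero_off_axes hp hz hWo hzW hG hGg hgoff

end Brick
end Summit.HodgeConjecture.HodgeConjecture.Theorems.CyclicUnitaryPowersFermatAffineEigenfunctions

end
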